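import Summits.QuantumFields.BalabanUV.Beta.D1BFx.TorusArrayLimitUniform
import Summits.QuantumFields.BalabanUV.Beta.D1BFx.SortedTraces

/-!
# «tendsto_hessT_sortK_hessKer_of_uniform» — the SORTED Hess limit for k-dependent families (road «BF-x», slot (K); ruling ρ-g7-8)

The N-side socket of TB5-3 (`KLimitGluon` over `SortedTraces.tendsto_hessT_sortK_hessKer`) in the k-INDEXED form the ruling ρ-g7-8 (journal l.26338)
asks for: the dressed gluon tables and the mixed straight weight jet are arrays of s-DEPENDENT `ℤ⁴` families `𝒱N k`, `𝒲N k` with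
(u1) `BiLoc` constants∕rate UNIFORM in `k` and (u2) ENTRYWISE limits `𝒱N∞`, `𝒲N∞`.  Proof = `SortedTraces`' reduction (`sortM`, `sortM_arr`,
`hessKer_sortM_apply`) applied to `TorusArrayLimitUniform.tendsto_hessT_hessKer_of_uniform`; the limit families inherit the uniform localisation
(`biLoc_of_tendsto_of_uniform`), which is what `hessKer_sortM_apply` needs to unsort the limit.  [folklore]; no definitions.
-/

noncomputable section

namespace Summit.QuantumFields.BalabanUV.Beta.D1BFx.SortedArrayLimitUniform

open Filter Topology
open scoped BigOperators
open Literature.Probability.LatticeModels (TorusSite Torus.proj)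
open Literature.MathematicalPhysics.QuantumFieldTheory.Balaban1983to89
open Literature.MathematicalPhysics.QuantumFieldTheory.Balaban1983to89.Beta
open ExpKernelCalculus (MKer Decays BiLoc hessKer shiftK)
open Summit.QuantumFields.BalabanUV.Beta.D1BFx.FibredPeriodisation (periodiseF)
open Summit.QuantumFields.BalabanUV.Beta.D1BFx.SortedPack (sortK)
open Summit.QuantumFields.BalabanUV.Beta.D1BFx.PeriodicArrays (arr toF)
open Summit.QuantumFields.BalabanUV.Beta.D1BFx.MixedVarPackedHess (hessT)
open Summit.QuantumFields.BalabanUV.Beta.D1BFx.SortedTraces (sortM sortM_apply toF_sortM decays_sortM biLoc_sortM sortM_imageShift sortM_arr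
  hessKer_sortM_apply)
open Summit.QuantumFields.BalabanUV.Beta.D1BFx.TorusArrayLimitUniform (tendsto_hessT_hessKer_of_uniform)

variable {D : ℕ} {F : Type*} {n : ℕ}

/-- [folklore] **A UNIFORMLY LOCALISED FAMILY HAS A LOCALISED LIMIT**: `BiLoc (K k) p q C δ` for all `k` and `K k → K∞` entrywise ⟹ `BiLoc K∞ p q C δ`
(the bound is a closed condition). -/
theorem biLoc_of_tendsto_of_uniform {G : Type*} {K : ℕ → MKer D G} {Kinf : MKer D G} {p q : Fin D → ℤ} {C δ : ℝ}
    (hK : ∀ k, BiLoc (K k) p q C δ) (hlim : ∀ x y a b, Tendsto (fun k => K k x y a b) atTop (𝓝 (Kinf x y a b))) : BiLoc Kinf p q C δ :=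
  fun x y a b => le_of_tendsto' ((hlim x y a b).abs) fun k => hK k x y a b

variable [NeZero n] [Fintype F]

/-- [folklore] **THE SORTED HESS LIMIT FOR k-DEPENDENT FAMILIES** (`SortedTraces.tendsto_hessT_sortK_hessKer` under (u1)+(u2)): with the embedded
pack `A` as there (decaying, block-covariant, multiplier rows∕columns off the coarse sublattice vanishing) and k-indexed base-point families
`𝒱 k`, `𝒲 k` whose `𝒱 k μ 0`, `𝒱 k ν z`, `𝒲 k μ 0 ν z` are bi-localised UNIFORMLY in `k` and converge ENTRYWISE to `𝒱∞`, `𝒲∞`: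
`hessT (sortK A)^ (sortK (arr (n·p k) (𝒱 k μ 0)))^ (sortK (arr (n·p k) (𝒱 k ν z)))^ (sortK (arr (n·p k) (𝒲 k μ 0 ν z)))^ → hessKer A 𝒱∞ 𝒲∞ μ ν z`. -/
theorem tendsto_hessT_sortK_hessKer_of_uniform {A : MKer D (F ⊕ F)} {CA δA : ℝ} (hA : Decays A CA δA) (hδA : 0 < δA)
    (hAcov : ∀ t : Fin D → ℤ, shiftK ((n : ℤ) • t) A = A)
    (hAr : ∀ x y f b, Torus.proj n x ≠ 0 → A x y (Sum.inr f) b = 0) (hAc : ∀ x y a f, Torus.proj n y ≠ 0 → A x y a (Sum.inr f) = 0)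
    (𝒱 : ℕ → Fin D → (Fin D → ℤ) → MKer D (F ⊕ F)) (𝒲 : ℕ → Fin D → (Fin D → ℤ) → Fin D → (Fin D → ℤ) → MKer D (F ⊕ F))
    (𝒱inf : Fin D → (Fin D → ℤ) → MKer D (F ⊕ F)) (𝒲inf : Fin D → (Fin D → ℤ) → Fin D → (Fin D → ℤ) → MKer D (F ⊕ F))
    (μ ν : Fin D) (z : Fin D → ℤ) {P P' Q Q' : Fin D → ℤ} {Cv Cv' C δ : ℝ}
    (hV : ∀ k, BiLoc (𝒱 k μ 0) P P' Cv δ) (hV' : ∀ k, BiLoc (𝒱 k ν z) Q' Q Cv' δ) (hW : ∀ k, BiLoc (𝒲 k μ 0 ν z) P Q C δ) (hδ : 0 < δ)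
    (hlimV : ∀ x y a b, Tendsto (fun k => 𝒱 k μ 0 x y a b) atTop (𝓝 (𝒱inf μ 0 x y a b)))
    (hlimV' : ∀ x y a b, Tendsto (fun k => 𝒱 k ν z x y a b) atTop (𝓝 (𝒱inf ν z x y a b)))
    (hlimW : ∀ x y a b, Tendsto (fun k => 𝒲 k μ 0 ν z x y a b) atTop (𝓝 (𝒲inf μ 0 ν z x y a b)))
    {p : ℕ → ℕ} [∀ k, NeZero (p k)] (hp : Tendsto p atTop atTop) :
    Tendsto (fun k => hessT (Matrix.of (periodiseF (p k) (sortK n A)))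
        (Matrix.of (periodiseF (p k) (sortK n (arr (n * p k) (𝒱 k μ 0)))))
        (Matrix.of (periodiseF (p k) (sortK n (arr (n * p k) (𝒱 k ν z)))))
        (Matrix.of (periodiseF (p k) (sortK n (arr (n * p k) (𝒲 k μ 0 ν z))))))
      atTop (𝓝 (hessKer A 𝒱inf 𝒲inf μ ν z)) := by
  have hA' := decays_sortM (n := n) hA hδA.le
  have hAper : ∀ k, ∀ x y t, ∀ a b : (TorusSite D n × F) ⊕ F,
      sortM n A (imageShift (p k) x t) (imageShift (p k) y t) a b = sortM n A x y a b :=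
    fun k x y t a b => sortM_imageShift hAcov (p k) x y t a b
  have h := tendsto_hessT_hessKer_of_uniform hA' hδA hAper (fun k μ' w => sortM n (𝒱 k μ' w)) (fun k μ' w ν' w' => sortM n (𝒲 k μ' w ν' w'))
    (fun μ' w => sortM n (𝒱inf μ' w)) (fun μ' w ν' w' => sortM n (𝒲inf μ' w ν' w')) μ ν z
    (fun k => biLoc_sortM (hV k) hδ.le) (fun k => biLoc_sortM (hV' k) hδ.le) (fun k => biLoc_sortM (hW k) hδ.le) hδ
    (fun x y a b => by simp only [sortM_apply]; exact hlimV _ _ _ _)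
    (fun x y a b => by simp only [sortM_apply]; exact hlimV' _ _ _ _)
    (fun x y a b => by simp only [sortM_apply]; exact hlimW _ _ _ _) hp
  rw [hessKer_sortM_apply ⟨_, _, hδA, hA⟩ hAr hAc 𝒱inf 𝒲inf ⟨_, _, _, _, hδ, biLoc_of_tendsto_of_uniform hV hlimV⟩
    ⟨_, _, _, _, hδ, biLoc_of_tendsto_of_uniform hV' hlimV'⟩ ⟨_, _, _, _, hδ, biLoc_of_tendsto_of_uniform hW hlimW⟩] at h
  simp only [← toF_sortM, sortM_arr]
  exact h

end Summit.QuantumFields.BalabanUV.Beta.D1BFx.SortedArrayLimitUniform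

end
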